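import Literature.AlgebraicGeometry.Resolution.SmoothImpliesRegular
import Literature.AlgebraicGeometry.Resolution.QuasiRegularSequences
import Mathlib.RingTheory.KrullDimension.Regular
import Mathlib.LinearAlgebra.FiniteDimensional.Lemmas
import HarnessLib

/-!
# The ideal of a regular quotient of a regular local ring is generated by a regular sequence

Topic: `Literature/AlgebraicGeometry/Resolution`. PROVED over Mathlib and the tree
(`SmoothImpliesRegular.lean`: `isRegularLocalRing_quotient_span`, Matsumura Thm. 14.2;
`RegularLocalRingsProofs.lean`: regular local rings are domains, Thm. 14.3;
`QuasiRegularSequences.lean`: Rees' theorem 16.2): for a regular local ring `(R, 𝔪, k)` and an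
ideal `J ⊆ 𝔪` with `R/J` regular, from any generating set `G` of `J` one can select
`f_1, …, f_c ∈ G` with `J = (f_1, …, f_c)` and `df_1, …, df_c` linearly independent in `𝔪/𝔪²`;
such elements form an `R`-sequence in any order and are quasi-regular. This is the local algebra
that makes a regular closed subscheme `Y` of a regular scheme `X` a regular immersion, and
reduces "the blowing up of `X` along `Y` is regular" (Liu, Thm. 8.1.19 (a)) to the affine
quasi-regular case proved in `AffineBlowupRegular.lean`.

* `not_mem_span_image_of_linearIndependent_toCotangent`,
  `injective_of_linearIndependent_toCotangent` — independence of differentials;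
* `isPrime_span_image_of_linearIndependent_toCotangent`,
  `mem_span_image_of_mul_mem_of_linearIndependent_toCotangent`,
  `isQuasiRegular_of_linearIndependent_toCotangent` — such elements generate prime ideals and
  form a quasi-regular `R`-sequence (Matsumura Thms. 14.2, 14.3, 16.2);
* `exists_finset_maximalIdeal_eq_span_sup` — lifting generators of `𝔪_{R/J}`;
* `exists_linearIndependent_of_subset_maximalIdeal` — selecting elements of `G` whose
  differentials form a basis of the image of `G` in `𝔪/𝔪²`;
* `exists_span_eq_of_isRegularLocalRing_quotient` — **the selected elements generate `J`**:
  `J' = (f) ⊆ J` is prime with `dim R/J' ≤ d - c` (Nakayama); were `J' ≠ J`, then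
  `dim R/J < dim R/J'`, so the regular ring `R/J` would have a maximal ideal with `< d - c`
  generators, and `𝔪 = (u) + J` would give `dim_k 𝔪/𝔪² < d`;
* `exists_isQuasiRegular_span_eq_of_isRegularLocalRing_quotient` — summary.

## Sources

* H. Matsumura, *Commutative Ring Theory*, CUP 1986, Thm. 14.2, Thm. 14.3, Thm. 16.2.
  [Matsumura1987]
* Q. Liu, *Algebraic Geometry and Arithmetic Curves*, OUP 2002, Thm. 8.1.19 and Exercise 8.1.4
  (the application). [Liu2002]
-/
noncomputable section

open IsLocalRing Module

namespace Literature.AlgebraicGeometry.Resolution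

universe u

variable {R : Type u} [CommRing R]

/-! ## Elements with linearly independent differentials form a regular sequence -/

section LinIndep

variable [IsLocalRing R] {c : ℕ} (f : Fin c → R) (hf : ∀ i, f i ∈ maximalIdeal R)
  (hli : LinearIndependent (ResidueField R) fun i => (maximalIdeal R).toCotangent ⟨f i, hf i⟩)

include hli in
/-- If `f_1, …, f_c ∈ 𝔪` have linearly independent images in `𝔪/𝔪²`, then no `f_i` lies in
the ideal generated by the others. [folklore] -/
theorem not_mem_span_image_of_linearIndependent_toCotangent (i : Fin c) (T : Set (Fin c))
    (hiT : i ∉ T) : f i ∉ Ideal.span (f '' T) := by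
  classical
  intro hi
  haveI : Fintype T := Fintype.ofFinite _
  rw [Set.image_eq_range] at hi
  obtain ⟨a, ha⟩ := Ideal.mem_span_range_iff_exists_fun.mp hi
  apply hli.notMem_span_image hiT
  -- `θ(f_i) = ∑ a_t θ(f_t)` lies in the span of the `θ(f_t)`, `t ∈ T`
  have heq : (⟨f i, hf i⟩ : maximalIdeal R) = ∑ t : T, a t • (⟨f t, hf t⟩ : maximalIdeal R) := by
    apply Subtype.ext
    simp only [AddSubmonoidClass.coe_finsetSum, SetLike.val_smul, smul_eq_mul]
    exact ha.symm
  rw [heq, map_sum]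
  refine Submodule.sum_mem _ fun t _ => ?_
  rw [LinearMap.map_smul_of_tower]
  exact Submodule.smul_of_tower_mem _ (a t) (Submodule.subset_span ⟨t, t.2, rfl⟩)

include hli in
/-- Linear independence of the differentials forces `f` to be injective. [folklore] -/
theorem injective_of_linearIndependent_toCotangent : Function.Injective f := fun i j h =>
  hli.injective (by simp only [h])

end LinIndep

section Regular

variable [IsRegularLocalRing R] {c : ℕ} (f : Fin c → R) (hf : ∀ i, f i ∈ maximalIdeal R)
  (hli : LinearIndependent (ResidueField R) fun i => (maximalIdeal R).toCotangent ⟨f i, hf i⟩)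

include hli in
/-- In a regular local ring, elements with linearly independent differentials generate prime
ideals — the quotients are regular local rings (Matsumura Thm. 14.2, tree
`isRegularLocalRing_quotient_span`), hence domains (Thm. 14.3). [cite: Matsumura1987, Thm. 14.2] -/
theorem isPrime_span_image_of_linearIndependent_toCotangent (T : Set (Fin c)) :
    (Ideal.span (f '' T)).IsPrime := by
  classical
  haveI : Fintype T := Fintype.ofFinite _
  have hinj := injective_of_linearIndependent_toCotangent f hf hli
  set s : Finset R := (Finset.univ : Finset T).image (fun t : T => f (t : Fin c)) with hs
  have hsT : (s : Set R) = f '' T := by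
    ext y
    simp only [hs, Finset.coe_image, Finset.coe_univ, Set.image_univ, Set.mem_range,
      Set.mem_image]
    constructor
    · rintro ⟨t, rfl⟩; exact ⟨t, t.2, rfl⟩
    · rintro ⟨j, hj, rfl⟩; exact ⟨⟨j, hj⟩, rfl⟩
  have hsm : (s : Set R) ⊆ maximalIdeal R := by
    rw [hsT]; rintro _ ⟨j, -, rfl⟩; exact hf j
  -- the family indexed by `s` is the family indexed by `T`, reindexed
  have hli' : LinearIndependent (ResidueField R)
      (fun x : s => (maximalIdeal R).toCotangent ⟨x, hsm x.2⟩) := by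
    -- `e : s → Fin c` choosing the index
    have hex : ∀ x : s, ∃ t : T, f t = x := fun x => by
      have hx := x.2
      rw [← Finset.mem_coe, hsT] at hx
      obtain ⟨j, hj, hjx⟩ := hx
      exact ⟨⟨j, hj⟩, hjx⟩
    choose e he using hex
    have heinj : Function.Injective (fun x : s => ((e x : T) : Fin c)) := by
      intro x y hxy
      apply Subtype.ext
      rw [← he x, ← he y]
      exact congrArg f hxy
    have := hli.comp _ heinj
    convert this using 1
    funext x
    simp only [Function.comp, he x]
  haveI := isRegularLocalRing_quotient_span s hsm hli'
  haveI := isDomain_of_isRegularLocalRing (R ⧸ Ideal.span (s : Set R))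
  rw [← hsT]
  exact (Ideal.Quotient.isDomain_iff_prime _).mp inferInstance

include hli in
/-- **Elements of a regular local ring with linearly independent differentials form an
`R`-sequence** (in every order): `f_i y ∈ (f_t : t ∈ T)` with `i ∉ T` forces
`y ∈ (f_t : t ∈ T)`. [cite: Matsumura1987, Thm. 14.2 with Thm. 14.3] -/
theorem mem_span_image_of_mul_mem_of_linearIndependent_toCotangent (i : Fin c)
    (T : Set (Fin c)) (hiT : i ∉ T) (y : R) (hy : f i * y ∈ Ideal.span (f '' T)) :
    y ∈ Ideal.span (f '' T) :=
  ((isPrime_span_image_of_linearIndependent_toCotangent f hf hli T).mem_or_mem hy).resolve_left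
    (not_mem_span_image_of_linearIndependent_toCotangent f hf hli i T hiT)

include hli in
/-- Hence such a family is quasi-regular (Rees, Matsumura Thm. 16.2).
[cite: Matsumura1987, Thm. 16.2] -/
theorem isQuasiRegular_of_linearIndependent_toCotangent : IsQuasiRegular f :=
  isQuasiRegular_of_regularSeq c f fun i y hy =>
    mem_span_image_of_mul_mem_of_linearIndependent_toCotangent f hf hli i (Set.Iio i)
      (fun h => lt_irrefl i h) y hy

end Regular

/-! ## The ideal of a regular quotient is generated by elements with independent differentials -/

section Generation

variable [IsRegularLocalRing R]

/-- Lifting a finite generating set of the maximal ideal of a quotient `R/J`: there is a finite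
`u ⊆ 𝔪` with `#u ≤ μ(𝔪_{R/J})` and `𝔪 = (u) + J`. [folklore] -/
theorem exists_finset_maximalIdeal_eq_span_sup {J : Ideal R} (hJ : J ≤ maximalIdeal R)
    [Nontrivial (R ⧸ J)] :
    haveI := IsLocalRing.of_surjective' (Ideal.Quotient.mk J) Ideal.Quotient.mk_surjective
    ∃ u : Finset R, (u : Set R) ⊆ maximalIdeal R ∧
      u.card ≤ (maximalIdeal (R ⧸ J)).spanFinrank ∧
      maximalIdeal R = Ideal.span (u : Set R) ⊔ J := by
  classical
  haveI := IsLocalRing.of_surjective' (Ideal.Quotient.mk J) Ideal.Quotient.mk_surjective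
  set mk := Ideal.Quotient.mk J with hmk
  set mbar := maximalIdeal (R ⧸ J) with hmbar
  have hfg : (mbar : Submodule (R ⧸ J) (R ⧸ J)).FG := IsNoetherian.noetherian mbar
  set gens := Submodule.generators (mbar : Submodule (R ⧸ J) (R ⧸ J)) with hgens
  have hgen : Ideal.span gens = mbar := Submodule.span_generators _
  have hfin : gens.Finite := Submodule.FG.finite_generators hfg
  have hcard : gens.ncard = Submodule.spanFinrank mbar := Submodule.FG.generators_ncard hfg
  let g : R ⧸ J → R := fun b => (Ideal.Quotient.mk_surjective b).choose
  have hg : ∀ b, mk (g b) = b := fun b => (Ideal.Quotient.mk_surjective b).choose_spec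
  set u : Finset R := hfin.toFinset.image g with hu
  have hmaxmap : mbar = (maximalIdeal R).map mk :=
    (map_maximalIdeal_of_surjective mk Ideal.Quotient.mk_surjective).symm
  refine ⟨u, ?_, ?_, ?_⟩
  · intro x hx
    rw [hu, Finset.coe_image] at hx
    obtain ⟨b, hb, rfl⟩ := hx
    rw [Set.Finite.coe_toFinset] at hb
    have hbm : mk (g b) ∈ mbar := by rw [hg, ← hgen]; exact Ideal.subset_span hb
    exact (IsLocalRing.mem_maximalIdeal _).mpr fun hunit =>
      (IsLocalRing.mem_maximalIdeal _).mp hbm (hunit.map mk)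
  · calc u.card ≤ hfin.toFinset.card := Finset.card_image_le
      _ = gens.ncard := (Set.ncard_eq_toFinset_card gens hfin).symm
      _ = _ := hcard
  · apply le_antisymm
    · intro y hy
      have hmy : mk y ∈ (Ideal.span (u : Set R)).map mk := by
        have h1 : mk '' (u : Set R) = gens := by
          rw [hu, Finset.coe_image, Set.Finite.coe_toFinset, Set.image_image]
          conv_rhs => rw [← Set.image_id gens]
          exact Set.image_congr fun b _ => hg b
        rw [Ideal.map_span, h1, hgen, hmaxmap]
        exact Ideal.mem_map_of_mem _ hy
      rw [← Ideal.mem_comap, Ideal.comap_map_of_surjective _ Ideal.Quotient.mk_surjective,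
        ← RingHom.ker_eq_comap_bot] at hmy
      rwa [Ideal.mk_ker] at hmy
    · refine sup_le (Ideal.span_le.mpr ?_) hJ
      intro x hx
      rw [hu, Finset.coe_image] at hx
      obtain ⟨b, hb, rfl⟩ := hx
      rw [Set.Finite.coe_toFinset] at hb
      have hbm : mk (g b) ∈ mbar := by rw [hg, ← hgen]; exact Ideal.subset_span hb
      exact (IsLocalRing.mem_maximalIdeal _).mpr fun hunit =>
        (IsLocalRing.mem_maximalIdeal _).mp hbm (hunit.map mk)

/-- **Selection**: from any set `G ⊆ 𝔪` one can select finitely many elements whose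
differentials form a basis of the span of the differentials of `G` in `𝔪/𝔪²`. [folklore] -/
theorem exists_linearIndependent_of_subset_maximalIdeal (G : Set R) (hGm : G ⊆ maximalIdeal R) :
    ∃ (c : ℕ) (f : Fin c → R) (hfG : ∀ i, f i ∈ G),
      LinearIndependent (ResidueField R)
        (fun i => (maximalIdeal R).toCotangent ⟨f i, hGm (hfG i)⟩) ∧
      Submodule.span (ResidueField R)
          (Set.range fun i => (maximalIdeal R).toCotangent ⟨f i, hGm (hfG i)⟩) =
        Submodule.span (ResidueField R)
          (Set.range fun g : G => (maximalIdeal R).toCotangent ⟨g, hGm g.2⟩) := by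
  classical
  set θ := (maximalIdeal R).toCotangent with hθ
  set Tset : Set (CotangentSpace R) := Set.range fun g : G => θ ⟨g, hGm g.2⟩ with hTset
  obtain ⟨b, hbT, hbspan, hbli⟩ := exists_linearIndependent (ResidueField R) Tset
  have hbfin : b.Finite := hbli.set_finite_of_isNoetherian
  haveI : Fintype b := hbfin.fintype
  set c := Fintype.card b
  let e : Fin c ≃ b := (Fintype.equivFin b).symm
  have hsel : ∀ v : b, ∃ g : G, θ ⟨g, hGm g.2⟩ = v := fun v => hbT v.2
  choose gsel hgsel using hsel
  refine ⟨c, fun i => gsel (e i), fun i => (gsel (e i)).2, ?_, ?_⟩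
  · have h1 := hbli.comp e e.injective
    convert h1 using 1
    funext i
    exact hgsel (e i)
  · have hrange : (Set.range fun i => θ ⟨(gsel (e i) : R), hGm (gsel (e i)).2⟩) = b := by
      ext v
      simp only [Set.mem_range]
      constructor
      · rintro ⟨i, rfl⟩
        rw [hgsel]
        exact (e i).2
      · intro hv
        exact ⟨e.symm ⟨v, hv⟩, by rw [hgsel, Equiv.apply_symm_apply]⟩
    rw [hrange, hbspan]

/-- **The ideal of a regular quotient of a regular local ring is generated by elements with
linearly independent differentials** (hence by an `R`-sequence, part of a regular system of
parameters): if `(R, 𝔪)` is a regular local ring and `J ⊆ 𝔪` is an ideal with `R/J` regular,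
then from any generating set `G` of `J` one can select `f_1, …, f_c ∈ G` with `J = (f_1, …, f_c)`
and `df_1, …, df_c` linearly independent in `𝔪/𝔪²`. Proof: select `f` with `df` a basis of
the image `V` of `J` in `𝔪/𝔪²`; `J' = (f) ⊆ J` is prime with `dim R/J' ≤ d - c` (Nakayama);
if `J' ≠ J` then `dim R/J < dim R/J' ≤ d - c`, so the regular ring `R/J` has a maximal ideal
with `< d - c` generators, and lifting them, `𝔪 = (u) + J` gives
`dim 𝔪/𝔪² ≤ #u + dim V < d`, a contradiction. [cite: Matsumura1987, Thm. 14.2] -/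
theorem exists_span_eq_of_isRegularLocalRing_quotient {J : Ideal R} (hJ : J ≤ maximalIdeal R)
    [hC : IsRegularLocalRing (R ⧸ J)] (G : Set R) (hG : Ideal.span G = J) :
    ∃ (c : ℕ) (f : Fin c → R) (hfG : ∀ i, f i ∈ G), Ideal.span (Set.range f) = J ∧
      LinearIndependent (ResidueField R)
        (fun i => (maximalIdeal R).toCotangent ⟨f i, hJ (hG ▸ Ideal.subset_span (hfG i))⟩) := by
  classical
  have hGJ : G ⊆ J := hG ▸ Ideal.subset_span
  have hGm : G ⊆ maximalIdeal R := hGJ.trans hJ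
  obtain ⟨c, f, hfG, hli, hspanV⟩ := exists_linearIndependent_of_subset_maximalIdeal G hGm
  refine ⟨c, f, hfG, ?_, hli⟩
  have hf : ∀ i, f i ∈ maximalIdeal R := fun i => hGm (hfG i)
  have hdfin : finrank (ResidueField R) (CotangentSpace R) = (maximalIdeal R).spanFinrank :=
    (spanFinrank_maximalIdeal_eq_finrank_cotangentSpace (R := R)).symm
  have hJ'J : Ideal.span (Set.range f) ≤ J :=
    Ideal.span_le.mpr (by rintro _ ⟨i, rfl⟩; exact hGJ (hfG i))
  by_contra hne
  haveI hJ'p : (Ideal.span (Set.range f)).IsPrime := by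
    have := isPrime_span_image_of_linearIndependent_toCotangent f hf hli Set.univ
    rwa [Set.image_univ] at this
  -- (1) Nakayama: `𝔪 = (f) + (t)` with `#t + c ≤ d`
  obtain ⟨t, htm, htcard, hmgen⟩ : ∃ t : Finset R, (t : Set R) ⊆ maximalIdeal R ∧
      t.card + c ≤ (maximalIdeal R).spanFinrank ∧
      maximalIdeal R = Ideal.span (Set.range f) ⊔ Ideal.span (t : Set R) := by
    let v : Fin c → CotangentSpace R := fun i => (maximalIdeal R).toCotangent ⟨f i, hf i⟩
    set V : Set (CotangentSpace R) := Set.range v with hV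
    have hvinj : Function.Injective v := hli.injective
    have hliV : LinearIndepOn (ResidueField R) id V := hli.linearIndepOn_id
    have hVcard : V.ncard = c := by
      rw [hV, Set.ncard_range_of_injective hvinj, Nat.card_eq_fintype_card, Fintype.card_fin]
    set T : Set (CotangentSpace R) := hliV.extend (Set.subset_univ _) with hT
    let bT : Basis T (ResidueField R) (CotangentSpace R) := Basis.extend hliV
    have hVT : V ⊆ T := hliV.subset_extend _
    have hTfin : T.Finite := Set.finite_coe_iff.mp (Module.Finite.finite_basis bT)
    have hcardT : T.ncard = (maximalIdeal R).spanFinrank := by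
      rw [spanFinrank_maximalIdeal_eq_finrank_cotangentSpace,
        Module.finrank_eq_nat_card_basis bT, Nat.card_coe_set_eq]
    have hspanT : Submodule.span (ResidueField R) T = ⊤ := by
      rw [← bT.span_eq, Basis.range_extend]
    let σ : CotangentSpace R → maximalIdeal R :=
      Function.surjInv (maximalIdeal R).toCotangent_surjective
    have hσ : ∀ w, (maximalIdeal R).toCotangent (σ w) = w :=
      Function.surjInv_eq (maximalIdeal R).toCotangent_surjective
    let sm : Set (maximalIdeal R) := Set.range fun i => (⟨f i, hf i⟩ : maximalIdeal R)
    let S : Set (maximalIdeal R) := sm ∪ σ '' (T \ V)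
    have hS : (maximalIdeal R).toCotangent '' S = T := by
      have h1 : (maximalIdeal R).toCotangent '' sm = V := by
        rw [hV, ← Set.range_comp]
        rfl
      simp only [S, Set.image_union, Set.image_image, hσ, Set.image_id', h1]
      exact Set.union_sdiff_cancel hVT
    have hspanS : Submodule.span R S = ⊤ := by
      rw [← CotangentSpace.span_image_eq_top_iff, hS, hspanT]
    set t₀ : Set R := (fun w : maximalIdeal R => (w : R)) '' (σ '' (T \ V)) with ht₀
    have ht₀fin : t₀.Finite := (hTfin.sdiff.image _).image _
    have ht₀card : t₀.ncard + c ≤ (maximalIdeal R).spanFinrank := by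
      have h1 : t₀.ncard ≤ (T \ V).ncard :=
        (Set.ncard_image_le (hTfin.sdiff.image _)).trans (Set.ncard_image_le hTfin.sdiff)
      have h2 : (T \ V).ncard + V.ncard = T.ncard :=
        Set.ncard_sdiff_add_ncard_of_subset hVT hTfin
      omega
    have hmgen : maximalIdeal R = Ideal.span (Set.range f) ⊔ Ideal.span t₀ := by
      have h1 : Set.range f ∪ t₀ = (maximalIdeal R).subtype '' S := by
        simp only [S, Set.image_union, Submodule.coe_subtype, ht₀]
        congr 1
        ext x
        simp only [sm, Set.mem_image, Set.mem_range]
        constructor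
        · rintro ⟨i, rfl⟩
          exact ⟨⟨f i, hf i⟩, ⟨i, rfl⟩, rfl⟩
        · rintro ⟨_, ⟨i, rfl⟩, rfl⟩
          exact ⟨i, rfl⟩
      rw [← Ideal.span_union, h1, Ideal.span, Submodule.span_image, hspanS, Submodule.map_top,
        Submodule.range_subtype]
    refine ⟨ht₀fin.toFinset, ?_, ?_, ?_⟩
    · rw [Set.Finite.coe_toFinset]
      rintro _ ⟨w, -, rfl⟩
      exact w.2
    · rw [← Set.ncard_eq_toFinset_card t₀ ht₀fin]
      exact ht₀card
    · rw [Set.Finite.coe_toFinset]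
      exact hmgen
  -- (2) `B = R/(f)` is a local domain of dimension `≤ d - c`
  haveI : IsDomain (R ⧸ Ideal.span (Set.range f)) :=
    (Ideal.Quotient.isDomain_iff_prime _).mpr hJ'p
  haveI : IsLocalRing (R ⧸ Ideal.span (Set.range f)) :=
    IsLocalRing.of_surjective' (Ideal.Quotient.mk _) Ideal.Quotient.mk_surjective
  obtain ⟨nB, hnB⟩ := exists_ringKrullDim_eq_natCast (R ⧸ Ideal.span (Set.range f))
  have hmaxB : maximalIdeal (R ⧸ Ideal.span (Set.range f)) =
      Ideal.span (Ideal.Quotient.mk (Ideal.span (Set.range f)) '' (t : Set R)) := by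
    rw [← map_maximalIdeal_of_surjective (Ideal.Quotient.mk (Ideal.span (Set.range f)))
      Ideal.Quotient.mk_surjective, hmgen, Ideal.map_sup, Ideal.map_quotient_self, Ideal.map_span,
      bot_sup_eq]
  have hdimB : nB + c ≤ (maximalIdeal R).spanFinrank := by
    have h1 : ringKrullDim (R ⧸ Ideal.span (Set.range f)) ≤
        (maximalIdeal (R ⧸ Ideal.span (Set.range f))).spanFinrank :=
      ringKrullDim_le_spanFinrank_maximalIdeal _
    have h2 : (maximalIdeal (R ⧸ Ideal.span (Set.range f))).spanFinrank ≤ t.card := by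
      rw [hmaxB]
      exact (Submodule.spanFinrank_span_le_ncard_of_finite ((t : Set R).toFinite.image _)).trans
        ((Set.ncard_image_le (t : Set R).toFinite).trans (Set.ncard_coe_finset t).le)
    have h3 : (nB : WithBot ℕ∞) ≤ ((t.card : ℕ) : WithBot ℕ∞) := by
      rw [← hnB]; exact h1.trans (by exact_mod_cast h2)
    have h4 : nB ≤ t.card := by exact_mod_cast h3
    omega
  -- (3) `C = R/J` has dimension `< dim B`: `j ∈ J ∖ (f)` is a nonzero element of the domain `B`
  obtain ⟨j, hjJ, hjJ'⟩ := SetLike.exists_of_lt (lt_of_le_of_ne hJ'J hne)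
  set bj : R ⧸ Ideal.span (Set.range f) := Ideal.Quotient.mk (Ideal.span (Set.range f)) j with hbj
  have hbj0 : bj ≠ 0 := fun h => hjJ' (Ideal.Quotient.eq_zero_iff_mem.mp h)
  have hbjm : bj ∈ maximalIdeal (R ⧸ Ideal.span (Set.range f)) := by
    rw [← map_maximalIdeal_of_surjective (Ideal.Quotient.mk (Ideal.span (Set.range f)))
      Ideal.Quotient.mk_surjective]
    exact Ideal.mem_map_of_mem _ (hJ hjJ)
  have hbjnzd : bj ∈ nonZeroDivisors (R ⧸ Ideal.span (Set.range f)) :=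
    mem_nonZeroDivisors_of_ne_zero hbj0
  have hdimbj := ringKrullDim_quotient_span_singleton_succ_eq_ringKrullDim_of_mem_nonZeroDivisors
    hbjnzd hbjm
  have hvan : ∀ a : R ⧸ Ideal.span (Set.range f), a ∈ Ideal.span {bj} →
      Ideal.Quotient.factor hJ'J a = 0 := by
    intro a ha
    obtain ⟨r, rfl⟩ := Ideal.mem_span_singleton'.mp ha
    rw [map_mul, hbj, Ideal.Quotient.factor_mk, Ideal.Quotient.eq_zero_iff_mem.mpr hjJ, mul_zero]
  have hsurj : Function.Surjective (Ideal.Quotient.lift (Ideal.span {bj})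
      (Ideal.Quotient.factor hJ'J) hvan) :=
    Ideal.Quotient.lift_surjective_of_surjective _ hvan (Ideal.Quotient.factor_surjective hJ'J)
  have hdimC_le := ringKrullDim_le_of_surjective _ hsurj
  haveI : Nontrivial ((R ⧸ Ideal.span (Set.range f)) ⧸ Ideal.span {bj}) :=
    Ideal.Quotient.nontrivial_iff.mpr fun h =>
      (IsLocalRing.maximalIdeal.isMaximal (R ⧸ Ideal.span (Set.range f))).ne_top
        (top_le_iff.mp (h ▸ (Ideal.span_singleton_le_iff_mem _).mpr hbjm))
  haveI : IsLocalRing ((R ⧸ Ideal.span (Set.range f)) ⧸ Ideal.span {bj}) :=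
    IsLocalRing.of_surjective' (Ideal.Quotient.mk _) Ideal.Quotient.mk_surjective
  obtain ⟨nb, hnb⟩ := exists_ringKrullDim_eq_natCast ((R ⧸ Ideal.span (Set.range f)) ⧸ Ideal.span {bj})
  obtain ⟨nC, hnC⟩ := exists_ringKrullDim_eq_natCast (R ⧸ J)
  have hdimC : nC + 1 ≤ nB := by
    rw [hnb, hnB] at hdimbj
    rw [hnb, hnC] at hdimC_le
    have h1 : nb + 1 = nB := by exact_mod_cast hdimbj
    have h2 : nC ≤ nb := by exact_mod_cast hdimC_le
    omega
  -- (4) the regular ring `C` has a maximal ideal with `nC < d - c` generators; lift them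
  have hCreg : (maximalIdeal (R ⧸ J)).spanFinrank = nC := by
    have := (isRegularLocalRing_iff _).mp hC
    rw [hnC] at this
    exact_mod_cast this
  obtain ⟨u, hum, hucard, hmu⟩ := exists_finset_maximalIdeal_eq_span_sup hJ
  rw [hCreg] at hucard
  -- (5) counting in `𝔪/𝔪²`: `𝔪 = (u) + J = (u) + (G)` forces `d ≤ #u + c`
  set S₀ : Set (maximalIdeal R) := {w | (w : R) ∈ (u : Set R)} ∪ {w | (w : R) ∈ G} with hS₀
  have hS₀span : Submodule.span R S₀ = ⊤ := by
    apply Submodule.map_injective_of_injective (maximalIdeal R).injective_subtype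
    rw [Submodule.map_span, Submodule.map_top, Submodule.range_subtype]
    have himg : ((maximalIdeal R).subtype : maximalIdeal R → R) '' S₀ = (u : Set R) ∪ G := by
      ext x
      simp only [Set.mem_image, hS₀, Set.mem_union, Set.mem_setOf_eq, Submodule.coe_subtype]
      constructor
      · rintro ⟨w, hw, rfl⟩
        exact hw
      · intro hx
        have hxm : x ∈ maximalIdeal R := hx.elim (fun h => hum h) (fun h => hGm h)
        exact ⟨⟨x, hxm⟩, hx, rfl⟩
    rw [himg]
    change Ideal.span ((u : Set R) ∪ G) = maximalIdeal R
    rw [Ideal.span_union, hG, ← hmu]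
  have hθS₀ : Submodule.span (ResidueField R) ((maximalIdeal R).toCotangent '' S₀) = ⊤ :=
    CotangentSpace.span_image_eq_top_iff.mpr hS₀span
  set uθ : Finset (CotangentSpace R) :=
    u.attach.image fun x => (maximalIdeal R).toCotangent ⟨x.1, hum x.2⟩ with huθ
  have hsub : (maximalIdeal R).toCotangent '' S₀ ⊆ (uθ : Set (CotangentSpace R)) ∪
      Set.range (fun g : G => (maximalIdeal R).toCotangent ⟨g, hGm g.2⟩) := by
    rintro _ ⟨w, hw | hw, rfl⟩
    · left
      rw [huθ, Finset.coe_image]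
      exact ⟨⟨w.1, hw⟩, Finset.mem_coe.mpr (Finset.mem_attach _ _), rfl⟩
    · right
      exact ⟨⟨w.1, hw⟩, rfl⟩
  set A : Submodule (ResidueField R) (CotangentSpace R) :=
    Submodule.span (ResidueField R) (uθ : Set (CotangentSpace R)) with hA
  set B : Submodule (ResidueField R) (CotangentSpace R) := Submodule.span (ResidueField R)
    (Set.range fun i => (maximalIdeal R).toCotangent ⟨f i, hGm (hfG i)⟩) with hB
  have hspanV' : (Submodule.span (ResidueField R)
      (Set.range fun i => (maximalIdeal R).toCotangent ⟨f i, hGm (hfG i)⟩) :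
        Submodule (ResidueField R) (CotangentSpace R)) =
      (Submodule.span (ResidueField R)
        (Set.range fun g : G => (maximalIdeal R).toCotangent ⟨g, hGm g.2⟩) :
          Submodule (ResidueField R) (CotangentSpace R)) := hspanV
  have hθS₀' : (Submodule.span (ResidueField R) ((maximalIdeal R).toCotangent '' S₀) :
      Submodule (ResidueField R) (CotangentSpace R)) = ⊤ := hθS₀
  have hle0 : (⊤ : Submodule (ResidueField R) (CotangentSpace R)) ≤
      Submodule.span (ResidueField R) (uθ : Set (CotangentSpace R)) ⊔ Submodule.span (ResidueField R)
        (Set.range fun i => (maximalIdeal R).toCotangent ⟨f i, hGm (hfG i)⟩) := by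
    rw [← hθS₀', hspanV', ← Submodule.span_union]
    exact Submodule.span_mono hsub
  have hle : (⊤ : Submodule (ResidueField R) (CotangentSpace R)) ≤ A ⊔ B := hle0
  have hfin1 : finrank (ResidueField R) A ≤ u.card :=
    (finrank_span_finset_le_card uθ).trans
      (Finset.card_image_le.trans (Finset.card_attach (s := u)).le)
  have hfin2 : finrank (ResidueField R) B = c := by
    rw [hB, finrank_span_eq_card hli, Fintype.card_fin]
  have key : (maximalIdeal R).spanFinrank ≤ u.card + c :=
    calc (maximalIdeal R).spanFinrank
        = finrank (ResidueField R) (⊤ : Submodule (ResidueField R) (CotangentSpace R)) := by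
          rw [finrank_top, hdfin]
      _ ≤ finrank (ResidueField R) ↥(A ⊔ B) := Submodule.finrank_mono hle
      _ ≤ finrank (ResidueField R) A + finrank (ResidueField R) B :=
          Submodule.finrank_add_le_finrank_add_finrank A B
      _ ≤ u.card + c := by rw [hfin2]; exact Nat.add_le_add_right hfin1 c
  omega

/-- **Summary**: the ideal `J ⊆ 𝔪` of a regular quotient `R/J` of a regular local ring `R` is
generated by a quasi-regular `R`-sequence selected from any generating set `G` of `J` — the
local algebra behind "a regular closed subscheme of a regular scheme is a regular immersion"
(Liu, §6.3) used to reduce Liu Thm. 8.1.19 (a) to the quasi-regular affine case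
(`AffineBlowupRegular.lean`). [cite: Matsumura1987, Thm. 14.2 with Thm. 16.2] -/
theorem exists_isQuasiRegular_span_eq_of_isRegularLocalRing_quotient {J : Ideal R}
    (hJ : J ≤ maximalIdeal R) [IsRegularLocalRing (R ⧸ J)] (G : Set R) (hG : Ideal.span G = J) :
    ∃ (c : ℕ) (f : Fin c → R), (∀ i, f i ∈ G) ∧ Ideal.span (Set.range f) = J ∧
      IsQuasiRegular f ∧
      ∀ (i : Fin c) (T : Set (Fin c)), i ∉ T → ∀ y : R,
        f i * y ∈ Ideal.span (f '' T) → y ∈ Ideal.span (f '' T) := by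
  obtain ⟨c, f, hfG, hspan, hli⟩ := exists_span_eq_of_isRegularLocalRing_quotient hJ G hG
  exact ⟨c, f, hfG, hspan, isQuasiRegular_of_linearIndependent_toCotangent f _ hli,
    fun i T hiT y hy =>
      mem_span_image_of_mul_mem_of_linearIndependent_toCotangent f _ hli i T hiT y hy⟩

end Generation

end Literature.AlgebraicGeometry.Resolution

end
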